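import Mathlib
import Summits.Ventures.PercRepro2.PointSplitBHK

/-!
# (PS1) and (PS) are THEOREMS for a leaf at the source without avoidance: Harris' coordinate split
(blind cell PercRepro2, night-3 g23, 2026-08-28; `proofs/NIGHT3-CERT.md` §32.14, §32.16)

Let `v` be a LEAF hanging from the source `s` by the single edge `e = {s, v}` (every edge at `v` is
`e`).  Then `v ∈ C_s ⟺ e is open` (`conn_leaf_iff`), so the point split at `v` is the COORDINATE
split of the product law at `e`, and with no avoidance (`X = Y = ∅`) the two point-split forms of
`PointSplitBHK.lean` are Harris' law of total covariance: writing `E¹, E⁰` for the laws with `e`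
pinned open / closed, `q = p_e`, `a = E¹[F], b = E⁰[F], c = E¹[G], d = E⁰[G], u = E¹[FG], w = E⁰[FG]`,

  `M(1_{vH}, 1) = q·[(1 − q)(u + w − ad − bc) + 2q(u − ac)]` and
  `M(1_{vH}, 1_{v̄H}) = q(1 − q)·(u + w − ad − bc)`,

both `≥ 0` because `u ≥ ac`, `w ≥ bd` (Harris for the pinned product laws, p1's
`expect_mul_expect_le_expect_mul`) and `a ≥ b`, `c ≥ d` (`expect_update_zero_le_expect_update_one`),
whence `u + w − ad − bc ≥ (a − b)(c − d) ≥ 0`.  Theorems `mixedForm_one_nonneg_sourceLeaf` and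
`mixedForm_split_nonneg_sourceLeaf`.  With avoidance the same leaf is the one-edge mixed BHK slack at a
source edge (§32.14) — open.  Own work; standard axioms.
-/

namespace Summit.Ventures.PercRepro2

open UnionCluster

namespace CovForm

namespace PointSplit

variable {V : Type*} {E : Type*} [Fintype E] [DecidableEq E]
  {R : Type*} [Field R] [LinearOrder R] [IsStrictOrderedRing R]

omit [Fintype E] [DecidableEq E] [LinearOrder R] [IsStrictOrderedRing R] in
/-- A leaf `v` with the single edge `e = {s, v}` is connected to `s` iff `e` is open. -/
lemma conn_leaf_iff {ends : E → Sym2 V} {e : E} {s v : V} (hsv : s ≠ v) (hends : ends e = s(s, v))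
    (hleaf : ∀ f, v ∈ ends f → f = e) (ω : Config E) :
    Conn ends ω s v ↔ ω e = true := by
  constructor
  · intro h
    by_contra hc
    have hc' : ω e = false := by simpa using hc
    have key := mem_of_conn_of_closed (S := {x : V | x ≠ v}) ?_ (show s ∈ {x : V | x ≠ v} from hsv) h
    · exact key rfl
    · intro x _ y hxy
      rw [openGraph_adj] at hxy
      obtain ⟨_, f, hf, hends'⟩ := hxy
      intro hyv
      subst hyv
      have hv : y ∈ ends f := by rw [hends']; exact Sym2.mem_mk_right x y
      have hfe := hleaf f hv
      subst hfe
      rw [hf] at hc'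
      exact Bool.noConfusion hc'
  · intro h
    exact conn_of_openAdj ⟨e, h, hends⟩

omit [Fintype E] [DecidableEq E] [LinearOrder R] [IsStrictOrderedRing R] in
/-- The point weight of a source leaf is the indicator of `e` open. -/
lemma indicator_conn_leaf {ends : E → Sym2 V} {e : E} {s v : V} (hsv : s ≠ v)
    (hends : ends e = s(s, v)) (hleaf : ∀ f, v ∈ ends f → f = e) (ω : Config E) :
    (connEvent ends s v).indicator (1 : Config E → R) ω = if ω e = true then 1 else 0 := by
  by_cases h : ω e = true
  · rw [Set.indicator_of_mem (show ω ∈ connEvent ends s v from (conn_leaf_iff hsv hends hleaf ω).2 h)]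
    simp [h]
  · rw [Set.indicator_of_notMem (show ω ∉ connEvent ends s v from
      fun hc => h ((conn_leaf_iff hsv hends hleaf ω).1 hc))]
    simp [h]

omit [LinearOrder R] [IsStrictOrderedRing R] in
/-- `E_p[φ · 1_{e open}] = p_e · E_{p[e:=1]}[φ]`. -/
lemma expect_mul_open_eq (p : E → R) (e : E) (φ : Config E → R) :
    expect p (fun ω => φ ω * (if ω e = true then 1 else 0)) =
      p e * expect (Function.update p e 1) φ := by
  rw [expect_eq_pin p _ e, expect_update_one, expect_update_zero, expect_update_one]
  have h1 : (fun ω => φ (Function.update ω e true) *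
      (if Function.update ω e true e = true then (1 : R) else 0)) =
      fun ω => φ (Function.update ω e true) := by
    funext ω; simp
  have h0 : (fun ω => φ (Function.update ω e false) *
      (if Function.update ω e false e = true then (1 : R) else 0)) = fun _ => 0 := by
    funext ω; simp
  rw [h1, h0]
  simp [expect]

omit [LinearOrder R] [IsStrictOrderedRing R] in
/-- `E_p[φ] = p_e · E¹[φ] + (1 − p_e) · E⁰[φ]` (restated). -/
lemma expect_pin' (p : E → R) (e : E) (φ : Config E → R) :
    expect p φ = p e * expect (Function.update p e 1) φ +
      (1 - p e) * expect (Function.update p e 0) φ :=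
  expect_eq_pin p φ e

omit [LinearOrder R] [IsStrictOrderedRing R] in
/-- With no avoided set, `wExpect` is a plain expectation. -/
lemma wExpect_empty (p : E → R) (ends : E → Sym2 V) (s : V) (F : Set V → R) (w : Config E → R) :
    wExpect p ends s ∅ F w = expect p (fun ω => F (cluster ends ω s) * w ω) := by
  unfold wExpect
  refine congrArg _ (funext fun ω => ?_)
  have : ω ∈ avoidAll ends s ∅ := fun x hx => absurd hx (Finset.notMem_empty x)
  rw [Set.indicator_of_mem this]
  simp

/-- **(PS1) for a leaf at the source, no avoidance** — Harris' coordinate split: for every product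
law and nonnegative monotone `F, G`, `M(1_{v ∈ C_s}, 1) ≥ 0` when `v` hangs from `s` by the single
edge `e`. -/
theorem mixedForm_one_nonneg_sourceLeaf [DecidableEq V] (p : E → R) (hp : IsProbVec p)
    {ends : E → Sym2 V} {e : E} {s v : V} (hsv : s ≠ v) (hends : ends e = s(s, v))
    (hleaf : ∀ f, v ∈ ends f → f = e) {F G : Set V → R} (hF : Monotone F) (hG : Monotone G) :
    0 ≤ mixedFormW p ends s ∅ ∅ F G ((connEvent ends s v).indicator 1) (fun _ => 1) := by
  have hp₁ : IsProbVec (Function.update p e 1) := hp.update e zero_le_one le_rfl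
  have hp₀ : IsProbVec (Function.update p e 0) := hp.update e le_rfl zero_le_one
  have hfm : Monotone (fun ω : Config E => F (cluster ends ω s)) :=
    fun ω ω' h => hF (cluster_mono h s)
  have hgm : Monotone (fun ω : Config E => G (cluster ends ω s)) :=
    fun ω ω' h => hG (cluster_mono h s)
  -- Harris for the two pinned laws and the monotonicity in the pin
  have hu := expect_mul_expect_le_expect_mul hp₁ hfm hgm
  have hw := expect_mul_expect_le_expect_mul hp₀ hfm hgm
  have hab := expect_update_zero_le_expect_update_one hp hfm e
  have hcd := expect_update_zero_le_expect_update_one hp hgm e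
  have hq0 := hp.nonneg e
  have hq1 := hp.le_one e
  -- the eight weighted expectations
  unfold mixedFormW
  simp only [Finset.inter_self, Finset.union_self]
  rw [wExpect_empty, wExpect_empty, wExpect_empty, wExpect_empty, wExpect_empty, wExpect_empty,
    wExpect_empty, wExpect_empty]
  simp only [indicator_conn_leaf hsv hends hleaf]
  rw [expect_mul_open_eq p e (fun ω => F (cluster ends ω s) * G (cluster ends ω s)),
    expect_mul_open_eq p e (fun _ => (1 : R)), expect_mul_open_eq p e (fun ω => F (cluster ends ω s)),
    expect_mul_open_eq p e (fun ω => G (cluster ends ω s))]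
  simp only [mul_one, expect_const]
  rw [expect_pin' p e (fun ω => F (cluster ends ω s) * G (cluster ends ω s)),
    expect_pin' p e (fun ω => F (cluster ends ω s)), expect_pin' p e (fun ω => G (cluster ends ω s))]
  have e1 : expect (Function.update p e 1) (fun ω => F (cluster ends ω s) * G (cluster ends ω s)) =
      expect (Function.update p e 1)
        ((fun ω : Config E => F (cluster ends ω s)) * fun ω => G (cluster ends ω s)) := rfl
  have e0 : expect (Function.update p e 0) (fun ω => F (cluster ends ω s) * G (cluster ends ω s)) =
      expect (Function.update p e 0)
        ((fun ω : Config E => F (cluster ends ω s)) * fun ω => G (cluster ends ω s)) := rfl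
  rw [e1, e0]
  set q := p e
  set a := expect (Function.update p e 1) (fun ω : Config E => F (cluster ends ω s))
  set b := expect (Function.update p e 0) (fun ω : Config E => F (cluster ends ω s))
  set c := expect (Function.update p e 1) (fun ω : Config E => G (cluster ends ω s))
  set d := expect (Function.update p e 0) (fun ω : Config E => G (cluster ends ω s))
  set u := expect (Function.update p e 1)
    ((fun ω : Config E => F (cluster ends ω s)) * fun ω => G (cluster ends ω s))
  set w := expect (Function.update p e 0)
    ((fun ω : Config E => F (cluster ends ω s)) * fun ω => G (cluster ends ω s))
  have key : 0 ≤ u + w - a * d - b * c := by nlinarith [hu, hw, hab, hcd]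
  have hq : 0 ≤ q * (1 - q) := mul_nonneg hq0 (by linarith)
  nlinarith [key, hu, hq, hq0, mul_nonneg hq0 hq0]

omit [Fintype E] [DecidableEq E] [LinearOrder R] [IsStrictOrderedRing R] in
/-- The complementary point weight of a source leaf is the indicator of `e` closed. -/
lemma indicator_conn_compl_leaf {ends : E → Sym2 V} {e : E} {s v : V} (hsv : s ≠ v)
    (hends : ends e = s(s, v)) (hleaf : ∀ f, v ∈ ends f → f = e) (ω : Config E) :
    ((connEvent ends s v)ᶜ).indicator (1 : Config E → R) ω = if ω e = true then 0 else 1 := by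
  by_cases h : ω e = true
  · rw [Set.indicator_of_notMem (show ω ∉ (connEvent ends s v)ᶜ from
      fun hc => hc ((conn_leaf_iff hsv hends hleaf ω).2 h))]
    simp [h]
  · rw [Set.indicator_of_mem (show ω ∈ (connEvent ends s v)ᶜ from
      fun hc => h ((conn_leaf_iff hsv hends hleaf ω).1 hc))]
    simp [h]

omit [LinearOrder R] [IsStrictOrderedRing R] in
/-- `E_p[φ · 1_{e closed}] = (1 − p_e) · E_{p[e:=0]}[φ]`. -/
lemma expect_mul_closed_eq (p : E → R) (e : E) (φ : Config E → R) :
    expect p (fun ω => φ ω * (if ω e = true then 0 else 1)) =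
      (1 - p e) * expect (Function.update p e 0) φ := by
  rw [expect_eq_pin p _ e, expect_update_one, expect_update_zero, expect_update_zero]
  have h1 : (fun ω => φ (Function.update ω e true) *
      (if Function.update ω e true e = true then (0 : R) else 1)) = fun _ => 0 := by
    funext ω; simp
  have h0 : (fun ω => φ (Function.update ω e false) *
      (if Function.update ω e false e = true then (0 : R) else 1)) =
      fun ω => φ (Function.update ω e false) := by
    funext ω; simp
  rw [h1, h0]
  simp [expect]

/-- **(PS) for a leaf at the source, no avoidance**: `M(1_{v ∈ C_s}, 1_{v ∉ C_s}) =
q(1 − q)(u + w − ad − bc) ≥ 0` when `v` hangs from `s` by the single edge `e`. -/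
theorem mixedForm_split_nonneg_sourceLeaf [DecidableEq V] (p : E → R) (hp : IsProbVec p)
    {ends : E → Sym2 V} {e : E} {s v : V} (hsv : s ≠ v) (hends : ends e = s(s, v))
    (hleaf : ∀ f, v ∈ ends f → f = e) {F G : Set V → R} (hF : Monotone F) (hG : Monotone G) :
    0 ≤ mixedFormW p ends s ∅ ∅ F G ((connEvent ends s v).indicator 1)
      (((connEvent ends s v)ᶜ).indicator 1) := by
  have hp₁ : IsProbVec (Function.update p e 1) := hp.update e zero_le_one le_rfl
  have hp₀ : IsProbVec (Function.update p e 0) := hp.update e le_rfl zero_le_one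
  have hfm : Monotone (fun ω : Config E => F (cluster ends ω s)) :=
    fun ω ω' h => hF (cluster_mono h s)
  have hgm : Monotone (fun ω : Config E => G (cluster ends ω s)) :=
    fun ω ω' h => hG (cluster_mono h s)
  have hu := expect_mul_expect_le_expect_mul hp₁ hfm hgm
  have hw := expect_mul_expect_le_expect_mul hp₀ hfm hgm
  have hab := expect_update_zero_le_expect_update_one hp hfm e
  have hcd := expect_update_zero_le_expect_update_one hp hgm e
  have hq0 := hp.nonneg e
  have hq1 := hp.le_one e
  unfold mixedFormW
  simp only [Finset.inter_self, Finset.union_self]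
  rw [wExpect_empty, wExpect_empty, wExpect_empty, wExpect_empty, wExpect_empty, wExpect_empty,
    wExpect_empty, wExpect_empty]
  simp only [indicator_conn_leaf hsv hends hleaf, indicator_conn_compl_leaf hsv hends hleaf]
  rw [expect_mul_open_eq p e (fun ω => F (cluster ends ω s) * G (cluster ends ω s)),
    expect_mul_open_eq p e (fun _ => (1 : R)), expect_mul_open_eq p e (fun ω => F (cluster ends ω s)),
    expect_mul_open_eq p e (fun ω => G (cluster ends ω s)),
    expect_mul_closed_eq p e (fun ω => F (cluster ends ω s) * G (cluster ends ω s)),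
    expect_mul_closed_eq p e (fun _ => (1 : R)),
    expect_mul_closed_eq p e (fun ω => F (cluster ends ω s)),
    expect_mul_closed_eq p e (fun ω => G (cluster ends ω s))]
  simp only [expect_const, mul_one]
  have e1 : expect (Function.update p e 1) (fun ω => F (cluster ends ω s) * G (cluster ends ω s)) =
      expect (Function.update p e 1)
        ((fun ω : Config E => F (cluster ends ω s)) * fun ω => G (cluster ends ω s)) := rfl
  have e0 : expect (Function.update p e 0) (fun ω => F (cluster ends ω s) * G (cluster ends ω s)) =
      expect (Function.update p e 0)
        ((fun ω : Config E => F (cluster ends ω s)) * fun ω => G (cluster ends ω s)) := rfl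
  rw [e1, e0]
  set q := p e
  set a := expect (Function.update p e 1) (fun ω : Config E => F (cluster ends ω s))
  set b := expect (Function.update p e 0) (fun ω : Config E => F (cluster ends ω s))
  set c := expect (Function.update p e 1) (fun ω : Config E => G (cluster ends ω s))
  set d := expect (Function.update p e 0) (fun ω : Config E => G (cluster ends ω s))
  set u := expect (Function.update p e 1)
    ((fun ω : Config E => F (cluster ends ω s)) * fun ω => G (cluster ends ω s))
  set w := expect (Function.update p e 0)
    ((fun ω : Config E => F (cluster ends ω s)) * fun ω => G (cluster ends ω s))
  have key : 0 ≤ u + w - a * d - b * c := by nlinarith [hu, hw, hab, hcd]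
  have hq : 0 ≤ q * (1 - q) := mul_nonneg hq0 (by linarith)
  nlinarith [key, hq]

end PointSplit

end CovForm

end Summit.Ventures.PercRepro2
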